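import Summits.BirchSwinnertonDyer.BirchSwinnertonDyer.Theorems.RamifiedHeegnerPairTwistUnitAdditive
import HarnessLib

/-!
# U₁ / U₀ at the single-ADDITIVE-carrier Gss2 classes — part P: `347400n1`, `353925h1`

Continuation of `…Theorems.RamifiedHeegnerPairTwistUnitAdditive` (seat `bsd-trib-w-rhp` g13; the doors `twistUnit[Zero]TwoSplit_of_sqrtField` and the
full framing are there): per rank-zero curve `subGss_three_<label>` (Addv ∧ SubGss at `3` in the kernel), `tamRowZ_/tamagawaProduct_<label>` (`∏ c_ℓ` in the
kernel), `localTamagawa_<q>_<label>` (`c(E/ℚ_q) = 3` in the kernel, the `hmono` input), Kraus minimality of `V = E^{(-3)}_min` and of the twist model `Wd`,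
and `u1_at_/u0_at_<label> : … → MissingUpperBoundAt W 3` by rhp-p2 g9 §4 / §4₀ (`RamifiedPairUpperBound.leafRank{One,Zero}Upper_three_monoCarrierAny_of_namedFacts_…`)
with print + the three named facts `h37 hPT hF1` as hypotheses and `hN hr Dt hc` + the twist `L`-data + `#Ш(Wd)_an` DISPLAYED (+ `bsd3_at_<label>` where the
lower half is free).  **HONEST FRAMING: theorems only; per-curve certificates under DISPLAYED inputs (conductor, analytic rank, `3 ∤ c(Dt)`, twist `L`-data, `#Ш(Wd)_an`) and
the printed / named facts of the road as hypotheses; nothing is booked, no item is closed; U₁ (26022) / U₀ (26024) / TU / L₀ / L₁ stay OPEN class-wide; BSD is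
NOT proved for any curve by this file.**
[cite: MatarNekovar2019, Thm. 0.7 (p. 456)] [cite: GrossZagier1986, Thm. I.(6.3) and (7.3)] [cite: GrossLMS1991, §1 and Prop. 3.7]
[cite: KrizLi2019, Thm. 1.20] [cite: Silverman1994, IV.9.4] [cite: Tate1975, §7] [cite: Kraus1989, Prop. 1] [cite: Cremona2006, Table 1]
[cite: SilvermanAEC2009, C.11 (CM j-invariants)]
-/

set_option linter.dupNamespace false
set_option autoImplicit false

noncomputable section

open scoped Classical NumberField

open WeierstrassCurve NumberField IsDedekindDomain IsDedekindDomain.HeightOneSpectrum Rat.HeightOneSpectrum Field Literature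
  Literature.NumberTheory.DiophantineGeometry Literature.NumberTheory.EllipticCurves Literature.NumberTheory.EllipticCurves.ModularForms
  Literature.NumberTheory.EllipticCurves.Rank1Residual Literature.NumberTheory.EllipticCurves.Rank1Residual.Typed Literature.NumberTheory.Automorphic
  Literature.NumberTheory.EllipticCurves.Rank1Residual.X11RankOneCertificates Literature.NumberTheory.EllipticCurves.KrizLi2019
  Literature.NumberTheory.GaloisRepresentations Literature.NumberTheory.QuadraticFields Summit.BirchSwinnertonDyer.BirchSwinnertonDyer.Rank1Residual.IntModel
  Summit.BirchSwinnertonDyer.BirchSwinnertonDyer.Rank2Observatory.Tam Summit.BirchSwinnertonDyer.Rank1Residual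
  Summit.BirchSwinnertonDyer.Rank1Residual.Additive Summit.BirchSwinnertonDyer.Rank1Residual.X11b Summit.BirchSwinnertonDyer.Rank1Residual.X11b.Three
  Summit.BirchSwinnertonDyer.Rank1Residual.GaloisImage Summit.BirchSwinnertonDyer.Rank1Residual.Supersingular
  Summit.BirchSwinnertonDyer.BirchSwinnertonDyer.Theses.RamifiedHeegnerPair Summit.BirchSwinnertonDyer.BirchSwinnertonDyer.Theorems
  Summit.BirchSwinnertonDyer.BirchSwinnertonDyer.Theorems.SchneiderFree Summit.BirchSwinnertonDyer.BirchSwinnertonDyer.Theorems.RamifiedPairUpperBound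
  Summit.BirchSwinnertonDyer.BirchSwinnertonDyer.Theorems.RamifiedHeegnerPairStepLIntrinsic
  Summit.BirchSwinnertonDyer.BirchSwinnertonDyer.Theorems.AdditiveBranchIMCGordTwoRankOne.HeegnerKolyvagin
  Summit.BirchSwinnertonDyer.BirchSwinnertonDyer.Theorems.RamifiedHeegnerPairTwistUnitIntrinsic

namespace Summit.BirchSwinnertonDyer.BirchSwinnertonDyer.Theorems.RamifiedHeegnerPairTwistUnitAdditive

/-! ## §29 `347400n1` = `[0, 0, 0, -2037375, -1118778750]`, `N = 347400 = 2^3·3^2·5^2·193` (`2`: I1*, `c = 4`, `3`: I₀*, `c = 1`, `5`: IV*, `c = 3`, `193`: I3, `c = 1`); `∏ c_ℓ = 12`, single carrier `q = 5` (IV*, ADDITIVE, `c_5 = 3`);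
`r_an = 0`, `#E(ℚ)_tors = 1`, `#Ш(E)_an = 1` (Cremona/LMFDB, displayed where used); class `347400n` of size 1.
`V = E^{(-3)}_min = [0, 0, 0, -226375, 41436250]` (`#Ṽ(𝔽₃) = 7`), `K = ℚ(√-191)`, `Wd = E^{(-191)}_min = [0, 0, 0, -74325477375, 7795506007541250]`: `L(E^{(-191)},1) = 0` (root number `-1`), `L'(E^{(-191)},1) ≠ 0`, `X := L'(F,1)·T²/(Ω·∏c·ĥ(P)) = [F(ℚ):ℤP]²·#Ш(F)_an = 1` EXACTLY (an integer to `76` digits) with the Heegner point `P ∈ F(ℚ)` of canonical height `ĥ(P) = 50.421248` found by the level-`N` engine (g12 `heeg2.gp`, kit j312623; `N(Wd) = 12673499400 = N·191²`, `∏c(Wd) = 12`, `#Wd(ℚ)_tors = 1`), whence `ord₃ #Ш(Wd)_an ≤ 0`. -/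

/-- `V = [0, 0, 0, -226375, 41436250]` (the minimal model of `347400n1^{(-3)}`, conductor `38600`): `Δ ≠ 0` in the kernel. [cite: Cremona2006, Table 1 (Cremona label 347400n1)] -/
theorem isElliptic_sV347400n1 : (⟨0, 0, 0, -226375, 41436250⟩ : WeierstrassCurve ℚ).IsElliptic :=
  isElliptic_of_discOf_ne_zero 0 0 0 (-226375) 41436250 (by decide +kernel)

/-- `V` is globally minimal: `|Δ| = 2^8·5^8·193^3` kernel-checked, Kraus' criterion prime by prime. [cite: Kraus1989, Prop. 1 and Prop. 2]
[cite: SilvermanAEC2009, VII.1 Remark 1.1] [cite: Cremona2006, Table 1 (Cremona label 347400n1)] -/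
theorem isGloballyMinimal_sV347400n1 : (⟨0, 0, 0, -226375, 41436250⟩ : WeierstrassCurve ℚ).IsGloballyMinimal :=
  isGloballyMinimal_of_krausCriterion₃_factored 0 0 0 (-226375) 41436250
    [(2, 8), (5, 8), (193, 3)] (by decide +kernel)
    (by intro qe hqe; simp only [List.mem_cons, List.not_mem_nil, or_false] at hqe
        rcases hqe with rfl | rfl | rfl <;> norm_num)
    (by set_option synthInstance.maxSize 2000 in decide +kernel)

/-- **`347400n1` is ADDITIVE at `3` and on the cell (G) ∧ ss, IN THE KERNEL**: `3 ∣ Δ`, `3 ∣ c₄`; `C • V^{(-3)} = E` (`[u, r, s, t] = [1, 0, 0, 0]`) with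
`V` globally minimal, `3 ∤ Δ(V)`, `#Ṽ(𝔽₃) = 7` (`a₃(V) = -3`, supersingular), whence `TypeG`, `SubGord`, `SubGss` at `3` as in the k1 records.
[cite: SilvermanAEC2009, VII.5 Prop. 5.1 (a), (c)] [cite: Delbourgo1998, §1.5 (G)] [cite: Cremona2006, Table 1 (Cremona label 347400n1)] -/
theorem subGss_three_347400n1 {W : WeierstrassCurve ℚ} [W.IsElliptic] [W.IsGloballyMinimal] (hWeq : W = (⟨0, 0, 0, -2037375, -1118778750⟩ : WeierstrassCurve ℚ)) :
    Addv W 3 ∧ SubGss W 3 := by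
  subst hWeq
  haveI := isElliptic_sV347400n1
  haveI := isGloballyMinimal_sV347400n1
  have hIW : integralModelInt (⟨0, 0, 0, -2037375, -1118778750⟩ : WeierstrassCurve ℚ) = (⟨0, 0, 0, -2037375, -1118778750⟩ : WeierstrassCurve ℤ) :=
    integralModelInt_eq_of_map_eq _ (map_mk_int 0 0 0 (-2037375) (-1118778750))
  have hadd : Addv (⟨0, 0, 0, -2037375, -1118778750⟩ : WeierstrassCurve ℚ) 3 := Additive.addv_of_intModel hIW 3 (by decide +kernel) (by decide +kernel)
  have hIV : integralModelInt (⟨0, 0, 0, -226375, 41436250⟩ : WeierstrassCurve ℚ) = (⟨0, 0, 0, -226375, 41436250⟩ : WeierstrassCurve ℤ) :=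
    integralModelInt_eq_of_map_eq _ (map_mk_int 0 0 0 (-226375) 41436250)
  have hcV : Nat.card ((((⟨0, 0, 0, -226375, 41436250⟩ : WeierstrassCurve ℤ)).map (Int.castRingHom (ZMod 3))).toAffine.Point) = 7 := by
    have h := natCard_point_eq_countPoints 0 0 0 (-226375) 41436250 3 (by norm_num) (by decide +kernel)
    have h' : countPoints [0, 0, 0, -226375, 41436250] 3 = 7 := countPoints_eq_of_fast (by decide +kernel)
    exact_mod_cast h.trans h'
  have hgood : GoodSS (⟨0, 0, 0, -226375, 41436250⟩ : WeierstrassCurve ℚ) 3 := Supersingular.goodSS_of_intModel 3 hIV (by decide +kernel) hcV (by decide)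
  have hVW : (⟨1, (0 : ℚ), (0 : ℚ), (0 : ℚ)⟩ : VariableChange ℚ) • (⟨0, 0, 0, -226375, 41436250⟩ : WeierstrassCurve ℚ).quadraticTwist (-3) =
      (⟨0, 0, 0, -2037375, -1118778750⟩ : WeierstrassCurve ℚ) := by
    ext <;> simp [WeierstrassCurve.variableChange_a₁, WeierstrassCurve.variableChange_a₂,
      WeierstrassCurve.variableChange_a₃, WeierstrassCurve.variableChange_a₄, WeierstrassCurve.variableChange_a₆,
      WeierstrassCurve.quadraticTwist, WeierstrassCurve.b₂, WeierstrassCurve.b₄, WeierstrassCurve.b₆] <;> norm_num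
  obtain ⟨C, hC⟩ := exists_variableChange_quadraticTwist_symm (⟨0, 0, 0, -2037375, -1118778750⟩ : WeierstrassCurve ℚ)
    (⟨0, 0, 0, -226375, 41436250⟩ : WeierstrassCurve ℚ) (d := (-3 : ℚ)) (by norm_num) ⟨_, hVW⟩
  have hC' : C • (⟨0, 0, 0, -2037375, -1118778750⟩ : WeierstrassCurve ℚ).quadraticTwist ((-1 : ℚ) ^ ((3 : ℕ) / 2) * (3 : ℕ)) =
      (⟨0, 0, 0, -226375, 41436250⟩ : WeierstrassCurve ℚ) := by
    rw [O5.pstar_three]; exact hC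
  have hG : TypeG (⟨0, 0, 0, -2037375, -1118778750⟩ : WeierstrassCurve ℚ) 3 := (typeG_three_iff_good_twist _ hadd _ C hC').mpr hgood.1
  exact ⟨hadd, (O5.subGss_three_iff_subGord_and_goodSS_twist _ hadd _ C hC).mpr
    ⟨subGord_three_of_typeG_of_addv _ hG hadd, hgood⟩⟩

/-- Row certificate of `347400n1` (stage-1 `TamLocal` at every bad prime, stage-2 `TamX` at the `IV`/`IV*` prime, stage-3 `TamZ` at the `I₀*`/`Iₙ*` primes):
checks in the kernel; emitted by n1011-p03 `tools/tamcert.py`, unchanged. [cite: Silverman1994, IV.9.4 Steps 2–7] [cite: Tate1975, §7] [cite: Cremona2006, Table 1 (Cremona label 347400n1)] -/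
theorem tamRowZ_347400n1 :
    TamZ.rowCheckZ [⟨2, 1, 5, 0, 1, 1, 2, 8, 71, 0, 4⟩, ⟨3, 1, 5, 0, 0, 0, 0, 6, 6, 0, 1⟩, ⟨5, 2, 5, 0, 0, 0, 0, 8, 8, 0, 3⟩, ⟨193, 13, 3, 0, 0, 0, 0, 3, 0, 0, 1⟩]
      [⟨5, 2, 3, 0, 0, 0, 8, 2⟩] [⟨2, 5, 1, 1, 2, 8, 0, 0⟩, ⟨3, 9, 0, 0, 0, 6, 0, 0⟩] (⟨0, 0, 0, -2037375, -1118778750⟩ : WeierstrassCurve ℤ) = true := by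
  decide +kernel

/-- **`∏_ℓ c_ℓ(347400n1) = 12` IN THE KERNEL** for any globally minimal `W / ℚ` with this integral model (Cremona: `12`; `ord₃ = 1`). [cite: Silverman1994, IV.9.4] -/
theorem tamagawaProduct_347400n1 {W : WeierstrassCurve ℚ} [W.IsGloballyMinimal]
    (hI : integralModelInt W = (⟨0, 0, 0, -2037375, -1118778750⟩ : WeierstrassCurve ℤ)) : W.tamagawaProduct = 12 :=
  (IntModelTam.tamagawaProduct_eq_rowValueZ_of_intModel hI tamRowZ_347400n1 (by decide +kernel)).trans (by decide +kernel)

/-- **`c(W/ℚ_5) = 3` IN THE KERNEL** (the carrier's LOCAL Tamagawa number) for any globally minimal `W / ℚ` with this model: Tate's algorithm at `5` to its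
exit (type IV*, `TamX` certificate, `c = 3`) through n1011-p19's bridge `IntModelTam.localTamagawaNumber_padic_eq_of_intModel_of_tamX`; the `hmono` input of the
mono-carrier road (`ord₃ ∏ c_ℓ = 1 = ord₃ c_5`). [cite: Silverman1994, IV.9.4] [cite: Tate1975, §7] [cite: Cremona2006, Table 1 (Cremona label 347400n1)] -/
theorem localTamagawa_five_347400n1 {W : WeierstrassCurve ℚ} [W.IsElliptic] [W.IsGloballyMinimal]
    (hI : integralModelInt W = (⟨0, 0, 0, -2037375, -1118778750⟩ : WeierstrassCurve ℤ)) :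
    haveI : Fact (Nat.Prime 5) := ⟨by norm_num⟩
    (W.baseChange ℚ_[5]).localTamagawaNumber ℤ_[5] = 3 :=
  haveI : Fact (Nat.Prime 5) := ⟨by norm_num⟩
  (IntModelTam.localTamagawaNumber_padic_eq_of_intModel_of_tamX hI 5 (F := ⟨5, 2, 3, 0, 0, 0, 8, 2⟩) rfl (by decide +kernel)).trans (by decide)

/-- `Wd = [0, 0, 0, -74325477375, 7795506007541250]` (the minimal model of the Heegner twist `347400n1^{(-191)}`, conductor `12673499400`): `Δ ≠ 0` in the kernel. [cite: Cremona2006, Table 1 (Cremona label 347400n1)] -/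
theorem isElliptic_sWd347400n1 : (⟨0, 0, 0, -74325477375, 7795506007541250⟩ : WeierstrassCurve ℚ).IsElliptic :=
  isElliptic_of_discOf_ne_zero 0 0 0 (-74325477375) 7795506007541250 (by decide +kernel)

/-- `Wd` is globally minimal: `|Δ| = 2^8·3^6·5^8·191^6·193^3` kernel-checked, Kraus' criterion prime by prime. [cite: Kraus1989, Prop. 1 and Prop. 2]
[cite: SilvermanAEC2009, VII.1 Remark 1.1] [cite: Cremona2006, Table 1 (Cremona label 347400n1)] -/
theorem isGloballyMinimal_sWd347400n1 : (⟨0, 0, 0, -74325477375, 7795506007541250⟩ : WeierstrassCurve ℚ).IsGloballyMinimal :=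
  isGloballyMinimal_of_krausCriterion₃_factored 0 0 0 (-74325477375) 7795506007541250
    [(2, 8), (3, 6), (5, 8), (191, 6), (193, 3)] (by decide +kernel)
    (by intro qe hqe; simp only [List.mem_cons, List.not_mem_nil, or_false] at hqe
        rcases hqe with rfl | rfl | rfl | rfl | rfl <;> norm_num)
    (by set_option synthInstance.maxSize 2000 in decide +kernel)

/-- **U₀ AT `347400n1` BY THE MONO-CARRIER TWIST-UNIT ROAD** — `MissingUpperBoundAt W 3` (`ord₃ #Ш(E) ≤ ord₃ #Ш(E)_an`) at `W = E` (`r_an = 0`) from rhp-p2 g9 §4₀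
`RamifiedPairUpperBound.leafRankZeroUpper_three_monoCarrierAny_of_namedFacts_of_twistUnitZeroTwoSplit` (p646215): PRINTED binders `hGZ hKo hGZK hmod hMN hmodP hCassels`
(Gross–Zagier ∀, Kolyvagin ∀, GZK, Version L, Matar–Nekovář 2019 Thm 0.7 irreducible form, modular parametrisations exist, Cassels) and the three NAMED tree facts
`h37 hPT hF1` (GrossLMS1991 Prop. 3.7(2), Poitou–Tate for Selmer structures, Gross 1991 (4.1) — research-level, displayed BY NAME); KERNEL: `∏ c_ℓ(E) = 12`
(`tamagawaProduct_347400n1`) and `c(E/ℚ_5) = 3` (`localTamagawa_five_347400n1`): `hmono` with the single ADDITIVE carrier `q = 5` (IV*); `¬ CM` (`j = 12829481418960/7189057`),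
`Addv ∧ SubGss` at `3` (`subGss_three_347400n1`), the field `K = ℚ(√-191)` (`-191 ≡ 1 (mod 8)`; `191` prime), the twist identity
`Cd • E^{(-191)} = Wd` (`Cd = [1, 0, 0, 0]`), Kraus minimality of `Wd` (`isGloballyMinimal_sWd347400n1`); DISPLAYED: `N(E) = 347400` (`hN`), `r_an(E) = 0` (`hr`), `Dt` with
`3 ∤ c(Dt)` (`hc`; Manin constant `1` for this optimal curve), `L(E^{(-191)},1) = 0` (`hL0`), `L'(E^{(-191)},1) ≠ 0` (`hL1`), `ord₃ #Ш(Wd)_an ≤ 0` (`hqd`/`hvd`; `X = 1`) — numerics in the section header.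
A per-curve certificate; U₀ (stmt 26024) stays OPEN class-wide; BSD is NOT proved by this. [cite: MatarNekovar2019, Thm. 0.7 (p. 456) and §0.11 (p. 457)]
[cite: GrossZagier1986, Thm. I.(6.3)] [cite: GrossLMS1991, Prop. 3.7] [cite: Miller2011LMS, Def. 1.1] [cite: Cremona2006, Table 1 (Cremona label 347400n1)] -/
theorem u0_at_347400n1
    (hGZ : ∀ (N : ℕ) [NeZero N] (W : WeierstrassCurve ℚ) (K : Type) [Field K] [NumberField K], gross_zagier N W K)
    (hKo : ∀ (N : ℕ) [NeZero N] (W : WeierstrassCurve ℚ) (K : Type) [Field K] [NumberField K], kolyvagin N W K)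
    (hGZK : rank_eq_analyticRank_of_analyticRank_le_one) (hmod : hasEntireLFunction_rat)
    (hMN : MatarNekovar2019.thm07_padicValNat_card_sha_primary_add_le_of_globalDivisibility_of_irreducible) (hmodP : nonempty_modularParametrizationData)
    (hCassels : bsdRHS_eq_of_isIsogenous) (h37 : GrossLMS1991.prop37_2_frobeniusCongruence)
    (hPT : ∀ (K : Type) [Field K] [NumberField K], Literature.NumberTheory.GaloisCohomology.poitouTate_selmerStructure_duality_conj K)
    (hF1 : Gross1991_heegnerPoint_sub_ratTorsion_mem_E0_imageFree)
    {W : WeierstrassCurve ℚ} [W.IsElliptic] [W.IsGloballyMinimal] (hWeq : W = (⟨0, 0, 0, -2037375, -1118778750⟩ : WeierstrassCurve ℚ))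
    (hN : W.conductorNorm ℤ = 347400) [NeZero (W.conductorNorm ℤ)] (hr : W.analyticRank = 0)
    (Dt : ModularParametrizationData W (W.conductorNorm ℤ)) (hc : ¬ (3 : ℤ) ∣ Dt.c)
    (hL0 : (W.quadraticTwist ((-191 : ℤ) : ℚ)).entireLFunction 1 = 0)
    (hL1 : deriv (W.quadraticTwist ((-191 : ℤ) : ℚ)).entireLFunction 1 ≠ 0)
    {qd : ℚ} (hqd : haveI := isElliptic_sWd347400n1; shaAn (⟨0, 0, 0, -74325477375, 7795506007541250⟩ : WeierstrassCurve ℚ) = (qd : ℂ))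
    (hvd : padicValRat 3 qd ≤ 0) :
    MissingUpperBoundAt W 3 := by
  subst hWeq
  haveI := isElliptic_sWd347400n1; haveI := isGloballyMinimal_sWd347400n1
  haveI : Fact ((-191 : ℤ) < 0) := ⟨by norm_num⟩
  haveI : Fact (Nat.Prime 5) := ⟨by norm_num⟩
  have hjac : ∀ ℓ : ℕ, ℓ.Prime → ℓ ∣ 347400 → ℓ ≠ 2 → jacobiSym (-191) ℓ = 1 := by
    intro ℓ hℓ hℓN hℓ2
    have hmem : ℓ ∈ Nat.primeFactors 347400 := Nat.mem_primeFactors.mpr ⟨hℓ, hℓN, by norm_num⟩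
    have hpf : Nat.primeFactors 347400 = {2, 3, 5, 193} := by decide +kernel
    rw [hpf] at hmem
    simp only [Finset.mem_insert, Finset.mem_singleton] at hmem
    rcases hmem with rfl | rfl | rfl | rfl
    · exact absurd rfl hℓ2
    all_goals (rw [jacobiSym.mod_left]; norm_num [jacobiSym.mod_left])
  have hWd : (⟨1, (0 : ℚ), (0 : ℚ), (0 : ℚ)⟩ : VariableChange ℚ) •
      (⟨0, 0, 0, -2037375, -1118778750⟩ : WeierstrassCurve ℚ).quadraticTwist ((-191 : ℤ) : ℚ) =
        (⟨0, 0, 0, -74325477375, 7795506007541250⟩ : WeierstrassCurve ℚ) := by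
    push_cast
    ext <;> simp [WeierstrassCurve.variableChange_a₁, WeierstrassCurve.variableChange_a₂,
      WeierstrassCurve.variableChange_a₃, WeierstrassCurve.variableChange_a₄, WeierstrassCurve.variableChange_a₆,
      WeierstrassCurve.quadraticTwist, WeierstrassCurve.b₂, WeierstrassCurve.b₄, WeierstrassCurve.b₆] <;> norm_num
  have hTU := twistUnitZeroTwoSplit_of_sqrtField _ 347400 (-191) (by norm_num)
    (by rw [show (-191 : ℤ).natAbs = 191 by rfl, Nat.squarefree_iff_nodup_primeFactorsList (by norm_num)]; simp)
    hjac hN hL0 hL1 _ _ hWd hqd hvd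
  have hI : integralModelInt (⟨0, 0, 0, -2037375, -1118778750⟩ : WeierstrassCurve ℚ) = (⟨0, 0, 0, -2037375, -1118778750⟩ : WeierstrassCurve ℤ) :=
    integralModelInt_eq_of_map_eq _ (map_mk_int 0 0 0 (-2037375) (-1118778750))
  have hmono : padicValNat 3 (⟨0, 0, 0, -2037375, -1118778750⟩ : WeierstrassCurve ℚ).tamagawaProduct ≤
      padicValNat 3 (((⟨0, 0, 0, -2037375, -1118778750⟩ : WeierstrassCurve ℚ).baseChange ℚ_[5]).localTamagawaNumber ℤ_[5]) := by
    rw [tamagawaProduct_347400n1 hI, localTamagawa_five_347400n1 hI]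
    exact le_of_eq (IntModelTam.padicValNat_eq_padicValNat_of_eq_mul (m := 4) Nat.prime_three (by norm_num) (by norm_num) (by norm_num))
  have hqN : 5 ∣ (⟨0, 0, 0, -2037375, -1118778750⟩ : WeierstrassCurve ℚ).conductorNorm ℤ := by rw [hN]; norm_num
  have hCM : ¬ (⟨0, 0, 0, -2037375, -1118778750⟩ : WeierstrassCurve ℚ).HasCM := fun hCM ↦ by
    have hj := (WeierstrassCurve.hasCM_iff_j_mem_holds (⟨0, 0, 0, -2037375, -1118778750⟩ : WeierstrassCurve ℚ)).1 hCM
    rw [WeierstrassCurve.j, Units.val_inv_eq_inv_val, WeierstrassCurve.coe_Δ'] at hj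
    simp only [cmJInvariants, Finset.mem_insert, Finset.mem_singleton] at hj
    norm_num [WeierstrassCurve.Δ, WeierstrassCurve.b₂, WeierstrassCurve.b₄, WeierstrassCurve.b₆, WeierstrassCurve.b₈,
      WeierstrassCurve.c₄] at hj
  have hGS := subGss_three_347400n1 (W := (⟨0, 0, 0, -2037375, -1118778750⟩ : WeierstrassCurve ℚ)) rfl
  exact leafRankZeroUpper_three_monoCarrierAny_of_namedFacts_of_twistUnitZeroTwoSplit hGZ hKo hGZK hmod hMN hmodP hCassels h37 hPT hF1
    _ hCM hGS.1 hGS.2 hr 5 hqN hmono Dt hc hTU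

/-- **BSD₃ AT `347400n1` modulo print, the named facts and displayed numerics** — `BSDp W 3` from `u0_at_347400n1` (upper half) and the LOWER half read off the
displayed analytic order `#Ш(E)_an = q` with `ord₃ q ≤ 0` (Cremona: `#Ш(E)_an = 1`, so `ord₃ q ≤ 0 ≤ ord₃ #Ш(E)` is free), glued by `Typed.missingPPartAt_of_lower_of_upper`
+ `Typed.bsdp_of_missingPPartAt` (GZK).  Per curve, CONDITIONAL on every displayed input; nothing booked; BSD is NOT proved by this.
[cite: Miller2011LMS, Def. 1.1] [cite: MatarNekovar2019, Thm. 0.7 (p. 456)] [cite: Cremona2006, Table 1 (Cremona label 347400n1)] -/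
theorem bsd3_at_347400n1
    (hGZ : ∀ (N : ℕ) [NeZero N] (W : WeierstrassCurve ℚ) (K : Type) [Field K] [NumberField K], gross_zagier N W K)
    (hKo : ∀ (N : ℕ) [NeZero N] (W : WeierstrassCurve ℚ) (K : Type) [Field K] [NumberField K], kolyvagin N W K)
    (hGZK : rank_eq_analyticRank_of_analyticRank_le_one) (hmod : hasEntireLFunction_rat)
    (hMN : MatarNekovar2019.thm07_padicValNat_card_sha_primary_add_le_of_globalDivisibility_of_irreducible) (hmodP : nonempty_modularParametrizationData)
    (hCassels : bsdRHS_eq_of_isIsogenous) (h37 : GrossLMS1991.prop37_2_frobeniusCongruence)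
    (hPT : ∀ (K : Type) [Field K] [NumberField K], Literature.NumberTheory.GaloisCohomology.poitouTate_selmerStructure_duality_conj K)
    (hF1 : Gross1991_heegnerPoint_sub_ratTorsion_mem_E0_imageFree)
    {W : WeierstrassCurve ℚ} [W.IsElliptic] [W.IsGloballyMinimal] (hWeq : W = (⟨0, 0, 0, -2037375, -1118778750⟩ : WeierstrassCurve ℚ))
    (hN : W.conductorNorm ℤ = 347400) [NeZero (W.conductorNorm ℤ)] (hr : W.analyticRank = 0)
    {q : ℚ} (hq : shaAn W = (q : ℂ)) (hv : padicValRat 3 q ≤ 0)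
    (Dt : ModularParametrizationData W (W.conductorNorm ℤ)) (hc : ¬ (3 : ℤ) ∣ Dt.c)
    (hL0 : (W.quadraticTwist ((-191 : ℤ) : ℚ)).entireLFunction 1 = 0)
    (hL1 : deriv (W.quadraticTwist ((-191 : ℤ) : ℚ)).entireLFunction 1 ≠ 0)
    {qd : ℚ} (hqd : haveI := isElliptic_sWd347400n1; shaAn (⟨0, 0, 0, -74325477375, 7795506007541250⟩ : WeierstrassCurve ℚ) = (qd : ℂ))
    (hvd : padicValRat 3 qd ≤ 0) :
    BSDp W 3 := by
  have hup : MissingUpperBoundAt W 3 := u0_at_347400n1 hGZ hKo hGZK hmod hMN hmodP hCassels h37 hPT hF1 hWeq hN hr Dt hc hL0 hL1 hqd hvd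
  have hlow : MissingLowerBoundAt W 3 := ⟨q, hq, hv.trans (by exact_mod_cast Nat.zero_le _)⟩
  exact Typed.bsdp_of_missingPPartAt _ 3 hGZK (by rw [hr]; exact zero_le_one) (Typed.missingPPartAt_of_lower_of_upper _ 3 hlow hup)

/-! ## §30 `353925h1` = `[0, 0, 1, -12375, -324844]`, `N = 353925 = 3^2·5^2·11^2·13` (`3`: I₀*, `c = 1`, `5`: IV*, `c = 3`, `11`: II, `c = 1`, `13`: I3, `c = 1`); `∏ c_ℓ = 3`, single carrier `q = 5` (IV*, ADDITIVE, `c_5 = 3`);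
`r_an = 0`, `#E(ℚ)_tors = 1`, `#Ш(E)_an = 1` (Cremona/LMFDB, displayed where used); class `353925h` of size 1.
`V = E^{(-3)}_min = [0, 0, 1, -1375, 12031]` (`#Ṽ(𝔽₃) = 1`), `K = ℚ(√-959)`, `Wd = E^{(-959)}_min = [0, 0, 1, -11381052375, 286503767225156]`: `L(E^{(-959)},1) = 0` (root number `-1`), `L'(E^{(-959)},1) ≠ 0`, `X := L'(F,1)·T²/(Ω·∏c·ĥ(P)) = [F(ℚ):ℤP]²·#Ш(F)_an = 4` EXACTLY (an integer to `60` digits) with the Heegner point `P ∈ F(ℚ)` of canonical height `ĥ(P) = 7.031577` found by the level-`N` engine (g12 `heeg2.gp`, kit j312623; `N(Wd) = 325498097925 = N·959²`, `∏c(Wd) = 12`, `#Wd(ℚ)_tors = 1`), whence `ord₃ #Ш(Wd)_an ≤ 0`. -/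

/-- `V = [0, 0, 1, -1375, 12031]` (the minimal model of `353925h1^{(-3)}`, conductor `39325`): `Δ ≠ 0` in the kernel. [cite: Cremona2006, Table 1 (Cremona label 353925h1)] -/
theorem isElliptic_sV353925h1 : (⟨0, 0, 1, -1375, 12031⟩ : WeierstrassCurve ℚ).IsElliptic :=
  isElliptic_of_discOf_ne_zero 0 0 1 (-1375) 12031 (by decide +kernel)

/-- `V` is globally minimal: `|Δ| = 5^8·11^2·13^3` kernel-checked, Kraus' criterion prime by prime. [cite: Kraus1989, Prop. 1 and Prop. 2]
[cite: SilvermanAEC2009, VII.1 Remark 1.1] [cite: Cremona2006, Table 1 (Cremona label 353925h1)] -/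
theorem isGloballyMinimal_sV353925h1 : (⟨0, 0, 1, -1375, 12031⟩ : WeierstrassCurve ℚ).IsGloballyMinimal :=
  isGloballyMinimal_of_krausCriterion₃_factored 0 0 1 (-1375) 12031
    [(5, 8), (11, 2), (13, 3)] (by decide +kernel)
    (by intro qe hqe; simp only [List.mem_cons, List.not_mem_nil, or_false] at hqe
        rcases hqe with rfl | rfl | rfl <;> norm_num)
    (by set_option synthInstance.maxSize 2000 in decide +kernel)

/-- **`353925h1` is ADDITIVE at `3` and on the cell (G) ∧ ss, IN THE KERNEL**: `3 ∣ Δ`, `3 ∣ c₄`; `C • V^{(-3)} = E` (`[u, r, s, t] = [1, 0, 0, 1/2]`) with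
`V` globally minimal, `3 ∤ Δ(V)`, `#Ṽ(𝔽₃) = 1` (`a₃(V) = 3`, supersingular), whence `TypeG`, `SubGord`, `SubGss` at `3` as in the k1 records.
[cite: SilvermanAEC2009, VII.5 Prop. 5.1 (a), (c)] [cite: Delbourgo1998, §1.5 (G)] [cite: Cremona2006, Table 1 (Cremona label 353925h1)] -/
theorem subGss_three_353925h1 {W : WeierstrassCurve ℚ} [W.IsElliptic] [W.IsGloballyMinimal] (hWeq : W = (⟨0, 0, 1, -12375, -324844⟩ : WeierstrassCurve ℚ)) :
    Addv W 3 ∧ SubGss W 3 := by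
  subst hWeq
  haveI := isElliptic_sV353925h1
  haveI := isGloballyMinimal_sV353925h1
  have hIW : integralModelInt (⟨0, 0, 1, -12375, -324844⟩ : WeierstrassCurve ℚ) = (⟨0, 0, 1, -12375, -324844⟩ : WeierstrassCurve ℤ) :=
    integralModelInt_eq_of_map_eq _ (map_mk_int 0 0 1 (-12375) (-324844))
  have hadd : Addv (⟨0, 0, 1, -12375, -324844⟩ : WeierstrassCurve ℚ) 3 := Additive.addv_of_intModel hIW 3 (by decide +kernel) (by decide +kernel)
  have hIV : integralModelInt (⟨0, 0, 1, -1375, 12031⟩ : WeierstrassCurve ℚ) = (⟨0, 0, 1, -1375, 12031⟩ : WeierstrassCurve ℤ) :=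
    integralModelInt_eq_of_map_eq _ (map_mk_int 0 0 1 (-1375) 12031)
  have hcV : Nat.card ((((⟨0, 0, 1, -1375, 12031⟩ : WeierstrassCurve ℤ)).map (Int.castRingHom (ZMod 3))).toAffine.Point) = 1 := by
    have h := natCard_point_eq_countPoints 0 0 1 (-1375) 12031 3 (by norm_num) (by decide +kernel)
    have h' : countPoints [0, 0, 1, -1375, 12031] 3 = 1 := countPoints_eq_of_fast (by decide +kernel)
    exact_mod_cast h.trans h'
  have hgood : GoodSS (⟨0, 0, 1, -1375, 12031⟩ : WeierstrassCurve ℚ) 3 := Supersingular.goodSS_of_intModel 3 hIV (by decide +kernel) hcV (by decide)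
  have hVW : (⟨1, (0 : ℚ), (0 : ℚ), ((1:ℚ)/2)⟩ : VariableChange ℚ) • (⟨0, 0, 1, -1375, 12031⟩ : WeierstrassCurve ℚ).quadraticTwist (-3) =
      (⟨0, 0, 1, -12375, -324844⟩ : WeierstrassCurve ℚ) := by
    ext <;> simp [WeierstrassCurve.variableChange_a₁, WeierstrassCurve.variableChange_a₂,
      WeierstrassCurve.variableChange_a₃, WeierstrassCurve.variableChange_a₄, WeierstrassCurve.variableChange_a₆,
      WeierstrassCurve.quadraticTwist, WeierstrassCurve.b₂, WeierstrassCurve.b₄, WeierstrassCurve.b₆] <;> norm_num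
  obtain ⟨C, hC⟩ := exists_variableChange_quadraticTwist_symm (⟨0, 0, 1, -12375, -324844⟩ : WeierstrassCurve ℚ)
    (⟨0, 0, 1, -1375, 12031⟩ : WeierstrassCurve ℚ) (d := (-3 : ℚ)) (by norm_num) ⟨_, hVW⟩
  have hC' : C • (⟨0, 0, 1, -12375, -324844⟩ : WeierstrassCurve ℚ).quadraticTwist ((-1 : ℚ) ^ ((3 : ℕ) / 2) * (3 : ℕ)) =
      (⟨0, 0, 1, -1375, 12031⟩ : WeierstrassCurve ℚ) := by
    rw [O5.pstar_three]; exact hC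
  have hG : TypeG (⟨0, 0, 1, -12375, -324844⟩ : WeierstrassCurve ℚ) 3 := (typeG_three_iff_good_twist _ hadd _ C hC').mpr hgood.1
  exact ⟨hadd, (O5.subGss_three_iff_subGord_and_goodSS_twist _ hadd _ C hC).mpr
    ⟨subGord_three_of_typeG_of_addv _ hG hadd, hgood⟩⟩

/-- Row certificate of `353925h1` (stage-1 `TamLocal` at every bad prime, stage-2 `TamX` at the `IV`/`IV*` prime, stage-3 `TamZ` at the `I₀*`/`Iₙ*` primes):
checks in the kernel; emitted by n1011-p03 `tools/tamcert.py`, unchanged. [cite: Silverman1994, IV.9.4 Steps 2–7] [cite: Tate1975, §7] [cite: Cremona2006, Table 1 (Cremona label 353925h1)] -/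
theorem tamRowZ_353925h1 :
    TamZ.rowCheckZ [⟨3, 1, 5, 0, 0, 0, 4, 6, 6, 0, 1⟩, ⟨5, 2, 5, 0, 0, 0, 12, 8, 8, 0, 3⟩, ⟨11, 3, 4, 0, 0, 0, 5, 2, 2, 1, 1⟩, ⟨13, 3, 3, 0, 0, 0, 0, 3, 0, 0, 1⟩]
      [⟨5, 2, 3, 0, 0, 12, 8, 0⟩] [⟨3, 9, 0, 0, 4, 6, 0, 0⟩] (⟨0, 0, 1, -12375, -324844⟩ : WeierstrassCurve ℤ) = true := by
  decide +kernel

/-- **`∏_ℓ c_ℓ(353925h1) = 3` IN THE KERNEL** for any globally minimal `W / ℚ` with this integral model (Cremona: `3`; `ord₃ = 1`). [cite: Silverman1994, IV.9.4] -/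
theorem tamagawaProduct_353925h1 {W : WeierstrassCurve ℚ} [W.IsGloballyMinimal]
    (hI : integralModelInt W = (⟨0, 0, 1, -12375, -324844⟩ : WeierstrassCurve ℤ)) : W.tamagawaProduct = 3 :=
  (IntModelTam.tamagawaProduct_eq_rowValueZ_of_intModel hI tamRowZ_353925h1 (by decide +kernel)).trans (by decide +kernel)

/-- **`c(W/ℚ_5) = 3` IN THE KERNEL** (the carrier's LOCAL Tamagawa number) for any globally minimal `W / ℚ` with this model: Tate's algorithm at `5` to its
exit (type IV*, `TamX` certificate, `c = 3`) through n1011-p19's bridge `IntModelTam.localTamagawaNumber_padic_eq_of_intModel_of_tamX`; the `hmono` input of the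
mono-carrier road (`ord₃ ∏ c_ℓ = 1 = ord₃ c_5`). [cite: Silverman1994, IV.9.4] [cite: Tate1975, §7] [cite: Cremona2006, Table 1 (Cremona label 353925h1)] -/
theorem localTamagawa_five_353925h1 {W : WeierstrassCurve ℚ} [W.IsElliptic] [W.IsGloballyMinimal]
    (hI : integralModelInt W = (⟨0, 0, 1, -12375, -324844⟩ : WeierstrassCurve ℤ)) :
    haveI : Fact (Nat.Prime 5) := ⟨by norm_num⟩
    (W.baseChange ℚ_[5]).localTamagawaNumber ℤ_[5] = 3 :=
  haveI : Fact (Nat.Prime 5) := ⟨by norm_num⟩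
  (IntModelTam.localTamagawaNumber_padic_eq_of_intModel_of_tamX hI 5 (F := ⟨5, 2, 3, 0, 0, 12, 8, 0⟩) rfl (by decide +kernel)).trans (by decide)

/-- `Wd = [0, 0, 1, -11381052375, 286503767225156]` (the minimal model of the Heegner twist `353925h1^{(-959)}`, conductor `325498097925`): `Δ ≠ 0` in the kernel. [cite: Cremona2006, Table 1 (Cremona label 353925h1)] -/
theorem isElliptic_sWd353925h1 : (⟨0, 0, 1, -11381052375, 286503767225156⟩ : WeierstrassCurve ℚ).IsElliptic :=
  isElliptic_of_discOf_ne_zero 0 0 1 (-11381052375) 286503767225156 (by decide +kernel)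

/-- `Wd` is globally minimal: `|Δ| = 3^6·5^8·7^6·11^2·13^3·137^6` kernel-checked, Kraus' criterion prime by prime. [cite: Kraus1989, Prop. 1 and Prop. 2]
[cite: SilvermanAEC2009, VII.1 Remark 1.1] [cite: Cremona2006, Table 1 (Cremona label 353925h1)] -/
theorem isGloballyMinimal_sWd353925h1 : (⟨0, 0, 1, -11381052375, 286503767225156⟩ : WeierstrassCurve ℚ).IsGloballyMinimal :=
  isGloballyMinimal_of_krausCriterion₃_factored 0 0 1 (-11381052375) 286503767225156
    [(3, 6), (5, 8), (7, 6), (11, 2), (13, 3), (137, 6)] (by decide +kernel)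
    (by intro qe hqe; simp only [List.mem_cons, List.not_mem_nil, or_false] at hqe
        rcases hqe with rfl | rfl | rfl | rfl | rfl | rfl <;> norm_num)
    (by set_option synthInstance.maxSize 2000 in decide +kernel)

/-- **U₀ AT `353925h1` BY THE MONO-CARRIER TWIST-UNIT ROAD** — `MissingUpperBoundAt W 3` (`ord₃ #Ш(E) ≤ ord₃ #Ш(E)_an`) at `W = E` (`r_an = 0`) from rhp-p2 g9 §4₀
`RamifiedPairUpperBound.leafRankZeroUpper_three_monoCarrierAny_of_namedFacts_of_twistUnitZeroTwoSplit` (p646215): PRINTED binders `hGZ hKo hGZK hmod hMN hmodP hCassels`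
(Gross–Zagier ∀, Kolyvagin ∀, GZK, Version L, Matar–Nekovář 2019 Thm 0.7 irreducible form, modular parametrisations exist, Cassels) and the three NAMED tree facts
`h37 hPT hF1` (GrossLMS1991 Prop. 3.7(2), Poitou–Tate for Selmer structures, Gross 1991 (4.1) — research-level, displayed BY NAME); KERNEL: `∏ c_ℓ(E) = 3`
(`tamagawaProduct_353925h1`) and `c(E/ℚ_5) = 3` (`localTamagawa_five_353925h1`): `hmono` with the single ADDITIVE carrier `q = 5` (IV*); `¬ CM` (`j = 6082560/2197`),
`Addv ∧ SubGss` at `3` (`subGss_three_353925h1`), the field `K = ℚ(√-959)` (`-959 ≡ 1 (mod 8)`; `959` = 7·137), the twist identity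
`Cd • E^{(-959)} = Wd` (`Cd = [1, 0, 0, 1/2]`), Kraus minimality of `Wd` (`isGloballyMinimal_sWd353925h1`); DISPLAYED: `N(E) = 353925` (`hN`), `r_an(E) = 0` (`hr`), `Dt` with
`3 ∤ c(Dt)` (`hc`; Manin constant `1` for this optimal curve), `L(E^{(-959)},1) = 0` (`hL0`), `L'(E^{(-959)},1) ≠ 0` (`hL1`), `ord₃ #Ш(Wd)_an ≤ 0` (`hqd`/`hvd`; `X = 4`) — numerics in the section header.
A per-curve certificate; U₀ (stmt 26024) stays OPEN class-wide; BSD is NOT proved by this. [cite: MatarNekovar2019, Thm. 0.7 (p. 456) and §0.11 (p. 457)]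
[cite: GrossZagier1986, Thm. I.(6.3)] [cite: GrossLMS1991, Prop. 3.7] [cite: Miller2011LMS, Def. 1.1] [cite: Cremona2006, Table 1 (Cremona label 353925h1)] -/
theorem u0_at_353925h1
    (hGZ : ∀ (N : ℕ) [NeZero N] (W : WeierstrassCurve ℚ) (K : Type) [Field K] [NumberField K], gross_zagier N W K)
    (hKo : ∀ (N : ℕ) [NeZero N] (W : WeierstrassCurve ℚ) (K : Type) [Field K] [NumberField K], kolyvagin N W K)
    (hGZK : rank_eq_analyticRank_of_analyticRank_le_one) (hmod : hasEntireLFunction_rat)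
    (hMN : MatarNekovar2019.thm07_padicValNat_card_sha_primary_add_le_of_globalDivisibility_of_irreducible) (hmodP : nonempty_modularParametrizationData)
    (hCassels : bsdRHS_eq_of_isIsogenous) (h37 : GrossLMS1991.prop37_2_frobeniusCongruence)
    (hPT : ∀ (K : Type) [Field K] [NumberField K], Literature.NumberTheory.GaloisCohomology.poitouTate_selmerStructure_duality_conj K)
    (hF1 : Gross1991_heegnerPoint_sub_ratTorsion_mem_E0_imageFree)
    {W : WeierstrassCurve ℚ} [W.IsElliptic] [W.IsGloballyMinimal] (hWeq : W = (⟨0, 0, 1, -12375, -324844⟩ : WeierstrassCurve ℚ))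
    (hN : W.conductorNorm ℤ = 353925) [NeZero (W.conductorNorm ℤ)] (hr : W.analyticRank = 0)
    (Dt : ModularParametrizationData W (W.conductorNorm ℤ)) (hc : ¬ (3 : ℤ) ∣ Dt.c)
    (hL0 : (W.quadraticTwist ((-959 : ℤ) : ℚ)).entireLFunction 1 = 0)
    (hL1 : deriv (W.quadraticTwist ((-959 : ℤ) : ℚ)).entireLFunction 1 ≠ 0)
    {qd : ℚ} (hqd : haveI := isElliptic_sWd353925h1; shaAn (⟨0, 0, 1, -11381052375, 286503767225156⟩ : WeierstrassCurve ℚ) = (qd : ℂ))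
    (hvd : padicValRat 3 qd ≤ 0) :
    MissingUpperBoundAt W 3 := by
  subst hWeq
  haveI := isElliptic_sWd353925h1; haveI := isGloballyMinimal_sWd353925h1
  haveI : Fact ((-959 : ℤ) < 0) := ⟨by norm_num⟩
  haveI : Fact (Nat.Prime 5) := ⟨by norm_num⟩
  have hjac : ∀ ℓ : ℕ, ℓ.Prime → ℓ ∣ 353925 → ℓ ≠ 2 → jacobiSym (-959) ℓ = 1 := by
    intro ℓ hℓ hℓN hℓ2
    have hmem : ℓ ∈ Nat.primeFactors 353925 := Nat.mem_primeFactors.mpr ⟨hℓ, hℓN, by norm_num⟩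
    have hpf : Nat.primeFactors 353925 = {3, 5, 11, 13} := by decide +kernel
    rw [hpf] at hmem
    simp only [Finset.mem_insert, Finset.mem_singleton] at hmem
    rcases hmem with rfl | rfl | rfl | rfl
    all_goals (rw [jacobiSym.mod_left]; norm_num [jacobiSym.mod_left])
  have hWd : (⟨1, (0 : ℚ), (0 : ℚ), ((1:ℚ)/2)⟩ : VariableChange ℚ) •
      (⟨0, 0, 1, -12375, -324844⟩ : WeierstrassCurve ℚ).quadraticTwist ((-959 : ℤ) : ℚ) =
        (⟨0, 0, 1, -11381052375, 286503767225156⟩ : WeierstrassCurve ℚ) := by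
    push_cast
    ext <;> simp [WeierstrassCurve.variableChange_a₁, WeierstrassCurve.variableChange_a₂,
      WeierstrassCurve.variableChange_a₃, WeierstrassCurve.variableChange_a₄, WeierstrassCurve.variableChange_a₆,
      WeierstrassCurve.quadraticTwist, WeierstrassCurve.b₂, WeierstrassCurve.b₄, WeierstrassCurve.b₆] <;> norm_num
  have hTU := twistUnitZeroTwoSplit_of_sqrtField _ 353925 (-959) (by norm_num)
    (by rw [show (-959 : ℤ).natAbs = 959 by rfl, Nat.squarefree_iff_nodup_primeFactorsList (by norm_num)]; simp)
    hjac hN hL0 hL1 _ _ hWd hqd hvd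
  have hI : integralModelInt (⟨0, 0, 1, -12375, -324844⟩ : WeierstrassCurve ℚ) = (⟨0, 0, 1, -12375, -324844⟩ : WeierstrassCurve ℤ) :=
    integralModelInt_eq_of_map_eq _ (map_mk_int 0 0 1 (-12375) (-324844))
  have hmono : padicValNat 3 (⟨0, 0, 1, -12375, -324844⟩ : WeierstrassCurve ℚ).tamagawaProduct ≤
      padicValNat 3 (((⟨0, 0, 1, -12375, -324844⟩ : WeierstrassCurve ℚ).baseChange ℚ_[5]).localTamagawaNumber ℤ_[5]) := by
    rw [tamagawaProduct_353925h1 hI, localTamagawa_five_353925h1 hI]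
  have hqN : 5 ∣ (⟨0, 0, 1, -12375, -324844⟩ : WeierstrassCurve ℚ).conductorNorm ℤ := by rw [hN]; norm_num
  have hCM : ¬ (⟨0, 0, 1, -12375, -324844⟩ : WeierstrassCurve ℚ).HasCM := fun hCM ↦ by
    have hj := (WeierstrassCurve.hasCM_iff_j_mem_holds (⟨0, 0, 1, -12375, -324844⟩ : WeierstrassCurve ℚ)).1 hCM
    rw [WeierstrassCurve.j, Units.val_inv_eq_inv_val, WeierstrassCurve.coe_Δ'] at hj
    simp only [cmJInvariants, Finset.mem_insert, Finset.mem_singleton] at hj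
    norm_num [WeierstrassCurve.Δ, WeierstrassCurve.b₂, WeierstrassCurve.b₄, WeierstrassCurve.b₆, WeierstrassCurve.b₈,
      WeierstrassCurve.c₄] at hj
  have hGS := subGss_three_353925h1 (W := (⟨0, 0, 1, -12375, -324844⟩ : WeierstrassCurve ℚ)) rfl
  exact leafRankZeroUpper_three_monoCarrierAny_of_namedFacts_of_twistUnitZeroTwoSplit hGZ hKo hGZK hmod hMN hmodP hCassels h37 hPT hF1
    _ hCM hGS.1 hGS.2 hr 5 hqN hmono Dt hc hTU

/-- **BSD₃ AT `353925h1` modulo print, the named facts and displayed numerics** — `BSDp W 3` from `u0_at_353925h1` (upper half) and the LOWER half read off the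
displayed analytic order `#Ш(E)_an = q` with `ord₃ q ≤ 0` (Cremona: `#Ш(E)_an = 1`, so `ord₃ q ≤ 0 ≤ ord₃ #Ш(E)` is free), glued by `Typed.missingPPartAt_of_lower_of_upper`
+ `Typed.bsdp_of_missingPPartAt` (GZK).  Per curve, CONDITIONAL on every displayed input; nothing booked; BSD is NOT proved by this.
[cite: Miller2011LMS, Def. 1.1] [cite: MatarNekovar2019, Thm. 0.7 (p. 456)] [cite: Cremona2006, Table 1 (Cremona label 353925h1)] -/
theorem bsd3_at_353925h1
    (hGZ : ∀ (N : ℕ) [NeZero N] (W : WeierstrassCurve ℚ) (K : Type) [Field K] [NumberField K], gross_zagier N W K)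
    (hKo : ∀ (N : ℕ) [NeZero N] (W : WeierstrassCurve ℚ) (K : Type) [Field K] [NumberField K], kolyvagin N W K)
    (hGZK : rank_eq_analyticRank_of_analyticRank_le_one) (hmod : hasEntireLFunction_rat)
    (hMN : MatarNekovar2019.thm07_padicValNat_card_sha_primary_add_le_of_globalDivisibility_of_irreducible) (hmodP : nonempty_modularParametrizationData)
    (hCassels : bsdRHS_eq_of_isIsogenous) (h37 : GrossLMS1991.prop37_2_frobeniusCongruence)
    (hPT : ∀ (K : Type) [Field K] [NumberField K], Literature.NumberTheory.GaloisCohomology.poitouTate_selmerStructure_duality_conj K)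
    (hF1 : Gross1991_heegnerPoint_sub_ratTorsion_mem_E0_imageFree)
    {W : WeierstrassCurve ℚ} [W.IsElliptic] [W.IsGloballyMinimal] (hWeq : W = (⟨0, 0, 1, -12375, -324844⟩ : WeierstrassCurve ℚ))
    (hN : W.conductorNorm ℤ = 353925) [NeZero (W.conductorNorm ℤ)] (hr : W.analyticRank = 0)
    {q : ℚ} (hq : shaAn W = (q : ℂ)) (hv : padicValRat 3 q ≤ 0)
    (Dt : ModularParametrizationData W (W.conductorNorm ℤ)) (hc : ¬ (3 : ℤ) ∣ Dt.c)
    (hL0 : (W.quadraticTwist ((-959 : ℤ) : ℚ)).entireLFunction 1 = 0)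
    (hL1 : deriv (W.quadraticTwist ((-959 : ℤ) : ℚ)).entireLFunction 1 ≠ 0)
    {qd : ℚ} (hqd : haveI := isElliptic_sWd353925h1; shaAn (⟨0, 0, 1, -11381052375, 286503767225156⟩ : WeierstrassCurve ℚ) = (qd : ℂ))
    (hvd : padicValRat 3 qd ≤ 0) :
    BSDp W 3 := by
  have hup : MissingUpperBoundAt W 3 := u0_at_353925h1 hGZ hKo hGZK hmod hMN hmodP hCassels h37 hPT hF1 hWeq hN hr Dt hc hL0 hL1 hqd hvd
  have hlow : MissingLowerBoundAt W 3 := ⟨q, hq, hv.trans (by exact_mod_cast Nat.zero_le _)⟩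
  exact Typed.bsdp_of_missingPPartAt _ 3 hGZK (by rw [hr]; exact zero_le_one) (Typed.missingPPartAt_of_lower_of_upper _ 3 hlow hup)

end Summit.BirchSwinnertonDyer.BirchSwinnertonDyer.Theorems.RamifiedHeegnerPairTwistUnitAdditive

end
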